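import Summits.HodgeConjecture.HodgeConjecture.Theorems.F0P6aChartFramePin   -- ★ p850217 twin of ED. 1 9cb8837e236e6097 (namespace KEPT ⇒ every FQN unchanged)
import HarnessLib

/-! # F0_P6a_ChartFramePin — ED. 2 = SHIM (rung-0 re-home; LEAD «M-72» (4) ∕ «M-78» CLASS III, «K3» sweep; dealer «L7» LA7-plan (g4))

The one declaration of ED. 1 (sha16 9cb8837e236e6097, 58 l., sorry-free: the frame pin `IsChartOfFrame`) now lives, byte for byte
and under the SAME namespace `Summit.HodgeConjecture.HodgeConjecture.Cruxes.HLiu418.F0P6aChartFramePin`, in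
★ `Theorems/F0P6aChartFramePin.lean` (p850217; RE-HOME TABLE v1.3.1 row 23; it imports ★ `Theorems.F0P6aPELWitnessEDefs` p850070 for
`AuxChartGS` ∕ `IsCMTypeThrough` ∕ `GSAdele`).  This module keeps its name so that its importers (`rg` 09:0xZ: `F0_P6a_StubEHECKE`,
`F0_P6a_StubESHEET`, `F0_P6a_EExports`) and by-name readers resolve unchanged through the import above; it declares nothing.
ORDER NOTE: written together with ∕ after the `F0_P6a_PELWitnessEDefs` shim (ED. 6) — all three importers also reach
`Lines.F0_P6a_PELWitnessEDefs` through `Lines.F0_P6a_PELInputs → Lines.F0_P6a_PELWitnessE`, so the (D) declarations must have ONE home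
when this import lands.  Edition history ED. 1 stays in the line card and in git; future changes are ★-side proposals on the
`Theorems/` file.  HC_CM is proved only modulo the 7 printed citations (2 remaining named inputs: hLiu418 = stmt-HodgeConjecture-24832,
h413 = stmt-HodgeConjecture-24833) until rung 0 closes; count-neutral (0 `sorry`, 0 socket, 0 declaration). -/
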